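import Mathlib
import HarnessLib
import Literature.Analysis.PDE.DivFormLiouville

/-!
# Route `PoloidalWindowDoor`, crux K2 (stmt-NavierStokesRegularity-19708) — task H5, step M1: CACCIOPPOLI inequalities for
# divergence-form elliptic equations with bounded measurable coefficients (towards `divFormLiouville_holds`, De Giorgi–Nash–Moser)

Setting = the rendering of the named fact `divFormLiouville` (Jost Thm 14.2.3; Moser 1961): `a` measurable symmetric,
`λ|ξ|² ≤ ξ·aξ`, `|aᵢⱼ| ≤ Λ`; `u ∈ C¹(ℝⁿ)` with `∫ Σᵢⱼ aᵢⱼ ∂ᵢu ∂ⱼη = 0` for all `η ∈ C¹_c`.  Step M1 of Moser's route (Moser 1961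
§4; Gilbarg–Trudinger §8.6): the ENERGY IDENTITY with a weight `g(u)` and the weighted Caccioppoli inequality.

* `quadForm_*` — algebra of the coefficient form `Q_y(ξ) = ξ·a(y)ξ`: symmetry of the bilinear form, the Cauchy–Schwarz
  inequality `(ξ·aζ)² ≤ (ξ·aξ)(ζ·aζ)`, and the bounds `λ|ξ|² ≤ ξ·aξ ≤ nΛ|ξ|²`.
* `weakForm_eq_dotProduct` — the integrand `Σᵢⱼ aᵢⱼ ∂ᵢu ∂ⱼη = Du · (a Dη)` with `Du = (∂ᵢu)ᵢ`.
* `energy_identity_weighted` — for `u` a weak solution with `u ≥ 1`, `g ∈ C¹(]½,∞[)` and `χ ∈ C¹_c`: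
  `∫ χ² g′(u) Q(Du) = −2 ∫ χ g(u) Du·a Dχ` (test function `η = χ² g(u)`).
* `caccioppoli_weighted` — if moreover `g′ > 0` on `]½,∞[`: `∫ χ² g′(u) Q(Du) ≤ 4 ∫ (g²/g′)(u) Q(Dχ)`.
(The specialisations `g = s^β/β` and `g = −1/s` — power and logarithmic Caccioppoli — are in the sequel file.)
Housed under the route's Theorems as a HELPER of the crux (the named fact's discharge `divFormLiouville_holds` will cite
Moser 1961 / Jost Thm 14.2.3 in Literature once M4 closes); seat ns-poloidal-K2-p3 g2, `ledger fact claim` #1.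

WHAT THIS IS NOT: not yet the Liouville theorem — the named fact stays OPEN until M4; nothing here is specific to
Navier–Stokes (consumer: the K2 lead's conditional `…EllipticSlope.eq_zero_of_ellipticShear`, p482138).
-/

noncomputable section

open MeasureTheory Set Function Filter Topology Metric
open scoped Matrix

-- the summit and its single sub-problem share the name (CONVENTIONS §1), as in every Theorems file
set_option linter.dupNamespace false

namespace Summit.NavierStokesRegularity.NavierStokesRegularity.Theorems.PoloidalWindowDoorPoloidalWindowRigidityDivFormCaccioppoli

variable {n : ℕ}

/-! ### The coefficient form -/

/-- The vector of partial derivatives `Du(y) = (∂ᵢu(y))ᵢ = (D u(y)[eᵢ])ᵢ`. -/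
theorem fderiv_single_eq_inner (u : EuclideanSpace ℝ (Fin n) → ℝ) (y : EuclideanSpace ℝ (Fin n)) (i : Fin n) :
    fderiv ℝ u y (EuclideanSpace.single i 1) = (InnerProductSpace.toDual ℝ _).symm (fderiv ℝ u y) i := by
  set g := (InnerProductSpace.toDual ℝ (EuclideanSpace ℝ (Fin n))).symm (fderiv ℝ u y) with hg
  have h : fderiv ℝ u y = InnerProductSpace.toDual ℝ _ g := by simp [hg]
  rw [h, InnerProductSpace.toDual_apply_apply, EuclideanSpace.inner_single_right]
  simp

/-- `Σᵢ (∂ᵢu)² = ‖Du‖²` (the operator norm of the derivative of a real function on `ℝⁿ` is the Euclidean norm of its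
gradient). -/
theorem sum_fderiv_single_sq (u : EuclideanSpace ℝ (Fin n) → ℝ) (y : EuclideanSpace ℝ (Fin n)) :
    ∑ i, fderiv ℝ u y (EuclideanSpace.single i 1) ^ 2 = ‖fderiv ℝ u y‖ ^ 2 := by
  set g := (InnerProductSpace.toDual ℝ (EuclideanSpace ℝ (Fin n))).symm (fderiv ℝ u y) with hg
  have hnorm : ‖fderiv ℝ u y‖ = ‖g‖ := by simp [hg]
  simp_rw [fderiv_single_eq_inner u y]
  rw [hnorm, EuclideanSpace.norm_eq, Real.sq_sqrt (Finset.sum_nonneg fun i _ => sq_nonneg _)]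
  simp [Real.norm_eq_abs, sq_abs, hg]

variable {a : EuclideanSpace ℝ (Fin n) → Matrix (Fin n) (Fin n) ℝ} {lam Λ : ℝ}

/-- Symmetry of the bilinear coefficient form: `ξ·a(y)ζ = ζ·a(y)ξ`. -/
theorem quadForm_symm (hsymm : ∀ y, (a y).IsSymm) (y : EuclideanSpace ℝ (Fin n)) (ξ ζ : Fin n → ℝ) :
    ξ ⬝ᵥ (a y *ᵥ ζ) = ζ ⬝ᵥ (a y *ᵥ ξ) := by
  rw [Matrix.dotProduct_mulVec, ← Matrix.mulVec_transpose, (hsymm y).eq, dotProduct_comm]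

/-- **Cauchy–Schwarz for the (positive semi-definite, symmetric) coefficient form**:
`(ξ·aζ)² ≤ (ξ·aξ)(ζ·aζ)`. -/
theorem quadForm_cauchySchwarz (hsymm : ∀ y, (a y).IsSymm) (hlam : 0 < lam)
    (hell : ∀ y (ξ : Fin n → ℝ), lam * (ξ ⬝ᵥ ξ) ≤ ξ ⬝ᵥ (a y *ᵥ ξ)) (y : EuclideanSpace ℝ (Fin n))
    (ξ ζ : Fin n → ℝ) :
    (ξ ⬝ᵥ (a y *ᵥ ζ)) ^ 2 ≤ (ξ ⬝ᵥ (a y *ᵥ ξ)) * (ζ ⬝ᵥ (a y *ᵥ ζ)) := by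
  have hpsd : ∀ θ : Fin n → ℝ, 0 ≤ θ ⬝ᵥ (a y *ᵥ θ) := fun θ =>
    (mul_nonneg hlam.le (by simpa [dotProduct] using Finset.sum_nonneg fun i _ => mul_self_nonneg (θ i))).trans
      (hell y θ)
  -- `t ↦ Q(ξ + tζ) = Q(ζ) t² + 2B(ξ,ζ) t + Q(ξ) ≥ 0`
  have hquad : ∀ t : ℝ, 0 ≤ (ζ ⬝ᵥ (a y *ᵥ ζ)) * (t * t) + 2 * (ξ ⬝ᵥ (a y *ᵥ ζ)) * t + ξ ⬝ᵥ (a y *ᵥ ξ) := by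
    intro t
    have h := hpsd (ξ + t • ζ)
    have hexp : (ξ + t • ζ) ⬝ᵥ (a y *ᵥ (ξ + t • ζ)) =
        ξ ⬝ᵥ (a y *ᵥ ξ) + t * (ξ ⬝ᵥ (a y *ᵥ ζ)) + t * (ζ ⬝ᵥ (a y *ᵥ ξ)) + t * t * (ζ ⬝ᵥ (a y *ᵥ ζ)) := by
      simp only [Matrix.mulVec_add, Matrix.mulVec_smul, dotProduct_add, add_dotProduct, dotProduct_smul,
        smul_dotProduct, smul_eq_mul]
      ring
    rw [hexp, quadForm_symm hsymm y ζ ξ] at h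
    linarith
  have hd := discrim_le_zero hquad
  rw [discrim] at hd
  nlinarith [hd]

/-- Lower bound of the coefficient form on a gradient vector: `λ Σᵢ ξᵢ² ≤ ξ·aξ`. -/
theorem quadForm_lower (hell : ∀ y (ξ : Fin n → ℝ), lam * (ξ ⬝ᵥ ξ) ≤ ξ ⬝ᵥ (a y *ᵥ ξ))
    (y : EuclideanSpace ℝ (Fin n)) (ξ : Fin n → ℝ) : lam * ∑ i, ξ i ^ 2 ≤ ξ ⬝ᵥ (a y *ᵥ ξ) := by
  have h := hell y ξ
  simpa [dotProduct, sq] using h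

/-- Upper bound of the coefficient form: `ξ·aξ ≤ nΛ Σᵢ ξᵢ²` (`|aᵢⱼ| ≤ Λ` and Cauchy–Schwarz). -/
theorem quadForm_upper (hbd : ∀ y i j, |a y i j| ≤ Λ) (y : EuclideanSpace ℝ (Fin n)) (ξ : Fin n → ℝ) :
    ξ ⬝ᵥ (a y *ᵥ ξ) ≤ n * Λ * ∑ i, ξ i ^ 2 := by
  rcases Nat.eq_zero_or_pos n with hn | hn
  · subst hn
    simp [dotProduct]
  have hΛ : 0 ≤ Λ := (abs_nonneg _).trans (hbd y ⟨0, hn⟩ ⟨0, hn⟩)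
  -- `|ξ·aξ| ≤ Λ (Σ|ξᵢ|)² ≤ Λ n Σ ξᵢ²`
  have h1 : ξ ⬝ᵥ (a y *ᵥ ξ) ≤ Λ * (∑ i, |ξ i|) ^ 2 := by
    calc ξ ⬝ᵥ (a y *ᵥ ξ) = ∑ i, ∑ j, a y i j * ξ i * ξ j := by
            simp only [dotProduct, Matrix.mulVec, Finset.mul_sum]
            refine Finset.sum_congr rfl fun i _ => Finset.sum_congr rfl fun j _ => by ring
      _ ≤ ∑ i, ∑ j, Λ * (|ξ i| * |ξ j|) := by
            refine Finset.sum_le_sum fun i _ => Finset.sum_le_sum fun j _ => ?_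
            calc a y i j * ξ i * ξ j ≤ |a y i j * ξ i * ξ j| := le_abs_self _
              _ = |a y i j| * (|ξ i| * |ξ j|) := by rw [abs_mul, abs_mul, mul_assoc]
              _ ≤ Λ * (|ξ i| * |ξ j|) := mul_le_mul_of_nonneg_right (hbd y i j) (by positivity)
      _ = Λ * (∑ i, |ξ i|) ^ 2 := by
            rw [sq, Finset.sum_mul_sum, Finset.mul_sum]
            refine Finset.sum_congr rfl fun i _ => ?_
            rw [Finset.mul_sum]
  have h2 : (∑ i, |ξ i|) ^ 2 ≤ n * ∑ i, ξ i ^ 2 := by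
    have h := sq_sum_le_card_mul_sum_sq (s := Finset.univ) (f := fun i => |ξ i|)
    simpa [sq_abs] using h
  calc ξ ⬝ᵥ (a y *ᵥ ξ) ≤ Λ * (∑ i, |ξ i|) ^ 2 := h1
    _ ≤ Λ * (n * ∑ i, ξ i ^ 2) := mul_le_mul_of_nonneg_left h2 hΛ
    _ = n * Λ * ∑ i, ξ i ^ 2 := by ring


/-- `Σᵢⱼ aᵢⱼ(y) Fᵢ Gⱼ = F · (a(y) G)` (the weak form as a bilinear pairing of gradient vectors). -/
theorem sum_sum_mul_eq_dotProduct (A : Matrix (Fin n) (Fin n) ℝ) (F G : Fin n → ℝ) :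
    ∑ i, ∑ j, A i j * F i * G j = F ⬝ᵥ (A *ᵥ G) := by
  simp only [dotProduct, Matrix.mulVec, Finset.mul_sum]
  exact Finset.sum_congr rfl fun i _ => Finset.sum_congr rfl fun j _ => by ring

/-- A measurable function dominated by a continuous one, times a continuous compactly supported function, is
integrable. -/
theorem integrable_mul_of_le_continuous {m M φ : EuclideanSpace ℝ (Fin n) → ℝ} (hm : Measurable m)
    (hM : Continuous M) (hle : ∀ y, |m y| ≤ M y) (hφ : Continuous φ) (hφc : HasCompactSupport φ) :
    Integrable (fun y => m y * φ y) := by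
  have hdom : Integrable (fun y => M y * |φ y|) :=
    (hM.mul (continuous_abs.comp hφ)).integrable_of_hasCompactSupport (hφc.norm.mul_left)
  refine hdom.mono' (hm.aestronglyMeasurable.mul hφ.aestronglyMeasurable) (Eventually.of_forall fun y => ?_)
  rw [Real.norm_eq_abs, abs_mul]
  exact mul_le_mul_of_nonneg_right (hle y) (abs_nonneg _)

variable {u : EuclideanSpace ℝ (Fin n) → ℝ}

/-- Measurability of `y ↦ F(y) · a(y) G(y)` for continuous vector functions `F, G` and measurable coefficients. -/
theorem measurable_dotProduct_mulVec (hmeas : ∀ i j, Measurable fun y => a y i j)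
    {F G : EuclideanSpace ℝ (Fin n) → Fin n → ℝ} (hF : ∀ i, Continuous fun y => F y i)
    (hG : ∀ j, Continuous fun y => G y j) : Measurable fun y => F y ⬝ᵥ (a y *ᵥ G y) := by
  have hfun : (fun y => F y ⬝ᵥ (a y *ᵥ G y)) = fun y => ∑ i, ∑ j, a y i j * F y i * G y j := by
    funext y; rw [sum_sum_mul_eq_dotProduct]
  rw [hfun]
  refine Finset.measurable_sum _ fun i _ => Finset.measurable_sum _ fun j _ => ?_
  exact ((hmeas i j).mul (hF i).measurable).mul (hG j).measurable

/-- The partial derivatives of a `C¹` function are continuous. -/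
theorem continuous_fderiv_single (hu : ContDiff ℝ 1 u) (i : Fin n) :
    Continuous fun y => fderiv ℝ u y (EuclideanSpace.single i 1) :=
  (hu.continuous_fderiv one_ne_zero).clm_apply continuous_const

/-- A pointwise bound for the bilinear form by a continuous function: `|F·aG| ≤ (F·aF + G·aG)/2 ≤ nΛ(ΣFᵢ² + ΣGⱼ²)/2`. -/
theorem abs_dotProduct_mulVec_le (hsymm : ∀ y, (a y).IsSymm) (hlam : 0 < lam)
    (hell : ∀ y (ξ : Fin n → ℝ), lam * (ξ ⬝ᵥ ξ) ≤ ξ ⬝ᵥ (a y *ᵥ ξ)) (hbd : ∀ y i j, |a y i j| ≤ Λ)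
    (y : EuclideanSpace ℝ (Fin n)) (F G : Fin n → ℝ) :
    |F ⬝ᵥ (a y *ᵥ G)| ≤ n * Λ * (∑ i, F i ^ 2 + ∑ j, G j ^ 2) / 2 := by
  have hcs := quadForm_cauchySchwarz hsymm hlam hell y F G
  have hF := quadForm_upper hbd y F
  have hG := quadForm_upper hbd y G
  have hF0 : 0 ≤ F ⬝ᵥ (a y *ᵥ F) :=
    (mul_nonneg hlam.le (Finset.sum_nonneg fun i _ => sq_nonneg (F i))).trans (quadForm_lower hell y F)
  have hG0 : 0 ≤ G ⬝ᵥ (a y *ᵥ G) :=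
    (mul_nonneg hlam.le (Finset.sum_nonneg fun i _ => sq_nonneg (G i))).trans (quadForm_lower hell y G)
  -- `|B| ≤ (Q(F) + Q(G))/2` from `B² ≤ Q(F) Q(G) ≤ ((Q(F)+Q(G))/2)²`
  have hsq : (F ⬝ᵥ (a y *ᵥ G)) ^ 2 ≤ ((F ⬝ᵥ (a y *ᵥ F) + G ⬝ᵥ (a y *ᵥ G)) / 2) ^ 2 := by
    nlinarith [sq_nonneg (F ⬝ᵥ (a y *ᵥ F) - G ⬝ᵥ (a y *ᵥ G))]
  have h1 : |F ⬝ᵥ (a y *ᵥ G)| ≤ (F ⬝ᵥ (a y *ᵥ F) + G ⬝ᵥ (a y *ᵥ G)) / 2 :=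
    abs_le_of_sq_le_sq hsq (by positivity)
  linarith

/-! ### Test functions `η = χ² g(u)` and the weighted energy identity -/

/-- For `u ∈ C¹` with `u ≥ 1`, `g ∈ C¹(]½,∞[)` and `χ ∈ C¹`: `η = χ² g(u)` is `C¹`. -/
theorem contDiff_testFun (hu : ContDiff ℝ 1 u) (hu1 : ∀ y, 1 ≤ u y) {g : ℝ → ℝ}
    (hg : ContDiffOn ℝ 1 g (Ioi (1 / 2))) {χ : EuclideanSpace ℝ (Fin n) → ℝ} (hχ : ContDiff ℝ 1 χ) :
    ContDiff ℝ 1 fun y => χ y ^ 2 * g (u y) := by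
  have hgu : ContDiff ℝ 1 fun y => g (u y) := by
    rw [contDiff_iff_contDiffAt]
    intro y
    have hy : u y ∈ Ioi (1 / 2 : ℝ) := by have := hu1 y; simp only [mem_Ioi]; linarith
    exact (hg.contDiffAt (Ioi_mem_nhds hy)).comp y hu.contDiffAt
  exact (hχ.pow 2).mul hgu

/-- … and compactly supported if `χ` is. -/
theorem hasCompactSupport_testFun {g : ℝ → ℝ} {χ : EuclideanSpace ℝ (Fin n) → ℝ} (hχc : HasCompactSupport χ) :
    HasCompactSupport fun y => χ y ^ 2 * g (u y) := by
  have h : HasCompactSupport fun y => χ y ^ 2 := hχc.comp_left (g := fun s : ℝ => s ^ 2) (by simp)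
  exact h.mul_right

/-- The partial derivatives of the test function: `∂ⱼ(χ² g(u)) = 2χ g(u) ∂ⱼχ + χ² g′(u) ∂ⱼu`. -/
theorem fderiv_testFun (hu : ContDiff ℝ 1 u) (hu1 : ∀ y, 1 ≤ u y) {g : ℝ → ℝ}
    (hg : ContDiffOn ℝ 1 g (Ioi (1 / 2))) {χ : EuclideanSpace ℝ (Fin n) → ℝ} (hχ : ContDiff ℝ 1 χ)
    (y : EuclideanSpace ℝ (Fin n)) (w : EuclideanSpace ℝ (Fin n)) :
    fderiv ℝ (fun y => χ y ^ 2 * g (u y)) y w =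
      2 * χ y * g (u y) * fderiv ℝ χ y w + χ y ^ 2 * deriv g (u y) * fderiv ℝ u y w := by
  have hy : u y ∈ Ioi (1 / 2 : ℝ) := by have := hu1 y; simp only [mem_Ioi]; linarith
  have hgd : HasDerivAt g (deriv g (u y)) (u y) :=
    ((hg.contDiffAt (Ioi_mem_nhds hy)).differentiableAt one_ne_zero).hasDerivAt
  have hud : HasFDerivAt u (fderiv ℝ u y) y := ((hu.differentiable one_ne_zero) y).hasFDerivAt
  have hχd : HasFDerivAt χ (fderiv ℝ χ y) y := ((hχ.differentiable one_ne_zero) y).hasFDerivAt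
  have hgu : HasFDerivAt (fun y => g (u y)) (deriv g (u y) • fderiv ℝ u y) y := hgd.comp_hasFDerivAt y hud
  have hχ2 : HasFDerivAt (fun y => χ y ^ 2) ((2 * χ y) • fderiv ℝ χ y) y := by
    have h := hχd.pow 2
    simpa using h
  have hprod := hχ2.mul hgu
  rw [show (fun y => χ y ^ 2 * g (u y)) = ((fun y => χ y ^ 2) * fun y => g (u y)) from rfl, hprod.fderiv]
  simp only [_root_.add_apply, FunLike.coe_smul, Pi.smul_apply, smul_eq_mul]
  ring

/-- **Weighted energy identity.**  Let `u ∈ C¹(ℝⁿ)`, `u ≥ 1`, be a weak solution (`∫ Σ aᵢⱼ ∂ᵢu ∂ⱼη = 0` for all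
`η ∈ C¹_c`), `g ∈ C¹(]½,∞[)`, `χ ∈ C¹_c`.  Then, with `Du = (∂ᵢu)ᵢ`, `Dχ = (∂ⱼχ)ⱼ`,
`∫ χ² g′(u) Du·a Du = −2 ∫ χ g(u) Du·a Dχ`. -/
theorem energy_identity_weighted (hsymm : ∀ y, (a y).IsSymm) (hlam : 0 < lam)
    (hmeas : ∀ i j, Measurable fun y => a y i j)
    (hell : ∀ y (ξ : Fin n → ℝ), lam * (ξ ⬝ᵥ ξ) ≤ ξ ⬝ᵥ (a y *ᵥ ξ)) (hbd : ∀ y i j, |a y i j| ≤ Λ)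
    (hu : ContDiff ℝ 1 u) (hu1 : ∀ y, 1 ≤ u y)
    (hweak : ∀ η : EuclideanSpace ℝ (Fin n) → ℝ, ContDiff ℝ 1 η → HasCompactSupport η →
      ∫ y, ∑ i, ∑ j, a y i j * fderiv ℝ u y (EuclideanSpace.single i 1) *
        fderiv ℝ η y (EuclideanSpace.single j 1) = 0)
    {g : ℝ → ℝ} (hg : ContDiffOn ℝ 1 g (Ioi (1 / 2)))
    {χ : EuclideanSpace ℝ (Fin n) → ℝ} (hχ : ContDiff ℝ 1 χ) (hχc : HasCompactSupport χ) :
    ∫ y, χ y ^ 2 * deriv g (u y) *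
        ((fun i => fderiv ℝ u y (EuclideanSpace.single i 1)) ⬝ᵥ
          (a y *ᵥ fun i => fderiv ℝ u y (EuclideanSpace.single i 1))) =
      -2 * ∫ y, χ y * g (u y) *
        ((fun i => fderiv ℝ u y (EuclideanSpace.single i 1)) ⬝ᵥ
          (a y *ᵥ fun j => fderiv ℝ χ y (EuclideanSpace.single j 1))) := by
  -- continuity facts
  have hcu := continuous_fderiv_single hu
  have hcχ := continuous_fderiv_single hχ
  have hgu : Continuous fun y => g (u y) :=
    (contDiff_testFun hu hu1 hg (contDiff_const (c := (1 : ℝ)))).continuous.congr fun y => by simp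
  have hg'u : Continuous fun y => deriv g (u y) := by
    have hg' : ContinuousOn (deriv g) (Ioi (1 / 2)) :=
      (hg.continuousOn_deriv_of_isOpen isOpen_Ioi le_rfl)
    refine hg'.comp_continuous hu.continuous fun y => ?_
    have := hu1 y; simp only [mem_Ioi]; linarith
  -- the test function and its gradient
  have hη := hweak _ (contDiff_testFun hu hu1 hg hχ) (hasCompactSupport_testFun hχc)
  have hpt : ∀ y, ∑ i, ∑ j, a y i j * fderiv ℝ u y (EuclideanSpace.single i 1) *
        fderiv ℝ (fun y => χ y ^ 2 * g (u y)) y (EuclideanSpace.single j 1) =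
      χ y ^ 2 * deriv g (u y) *
          ((fun i => fderiv ℝ u y (EuclideanSpace.single i 1)) ⬝ᵥ
            (a y *ᵥ fun i => fderiv ℝ u y (EuclideanSpace.single i 1))) +
        2 * (χ y * g (u y) *
          ((fun i => fderiv ℝ u y (EuclideanSpace.single i 1)) ⬝ᵥ
            (a y *ᵥ fun j => fderiv ℝ χ y (EuclideanSpace.single j 1)))) := by
    intro y
    rw [← sum_sum_mul_eq_dotProduct, ← sum_sum_mul_eq_dotProduct]
    simp only [fderiv_testFun hu hu1 hg hχ y, Finset.mul_sum, ← Finset.sum_add_distrib]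
    exact Finset.sum_congr rfl fun i _ => Finset.sum_congr rfl fun j _ => by ring
  simp_rw [hpt] at hη
  -- integrability of the two summands
  have hI1 : Integrable fun y => χ y ^ 2 * deriv g (u y) *
      ((fun i => fderiv ℝ u y (EuclideanSpace.single i 1)) ⬝ᵥ
        (a y *ᵥ fun i => fderiv ℝ u y (EuclideanSpace.single i 1))) := by
    have h := integrable_mul_of_le_continuous (n := n)
      (m := fun y => (fun i => fderiv ℝ u y (EuclideanSpace.single i 1)) ⬝ᵥ
        (a y *ᵥ fun i => fderiv ℝ u y (EuclideanSpace.single i 1)))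
      (M := fun y => n * Λ * (∑ i, fderiv ℝ u y (EuclideanSpace.single i 1) ^ 2 +
        ∑ j, fderiv ℝ u y (EuclideanSpace.single j 1) ^ 2) / 2)
      (φ := fun y => χ y ^ 2 * deriv g (u y))
      (measurable_dotProduct_mulVec hmeas hcu hcu) (by fun_prop)
      (fun y => abs_dotProduct_mulVec_le hsymm hlam hell hbd y _ _) ((hχ.continuous.pow 2).mul hg'u)
      ((hasCompactSupport_testFun (u := u) (g := deriv g) hχc))
    exact h.congr (Eventually.of_forall fun y => by ring)
  have hI2 : Integrable fun y => χ y * g (u y) *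
      ((fun i => fderiv ℝ u y (EuclideanSpace.single i 1)) ⬝ᵥ
        (a y *ᵥ fun j => fderiv ℝ χ y (EuclideanSpace.single j 1))) := by
    have h := integrable_mul_of_le_continuous (n := n)
      (m := fun y => (fun i => fderiv ℝ u y (EuclideanSpace.single i 1)) ⬝ᵥ
        (a y *ᵥ fun j => fderiv ℝ χ y (EuclideanSpace.single j 1)))
      (M := fun y => n * Λ * (∑ i, fderiv ℝ u y (EuclideanSpace.single i 1) ^ 2 +
        ∑ j, fderiv ℝ χ y (EuclideanSpace.single j 1) ^ 2) / 2)
      (φ := fun y => χ y * g (u y))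
      (measurable_dotProduct_mulVec hmeas hcu hcχ) (by fun_prop)
      (fun y => abs_dotProduct_mulVec_le hsymm hlam hell hbd y _ _) (hχ.continuous.mul hgu)
      (hχc.mul_right)
    exact h.congr (Eventually.of_forall fun y => by ring)
  rw [integral_add hI1 (hI2.const_mul 2), integral_const_mul] at hη
  linarith

/-- **Weighted Caccioppoli inequality.**  In the setting of `energy_identity_weighted`, if moreover `g′ > 0` on
`]½,∞[`, then `∫ χ² g′(u) Du·aDu ≤ 4 ∫ (g(u)²/g′(u)) Dχ·aDχ`. -/
theorem caccioppoli_weighted (hsymm : ∀ y, (a y).IsSymm) (hlam : 0 < lam)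
    (hmeas : ∀ i j, Measurable fun y => a y i j)
    (hell : ∀ y (ξ : Fin n → ℝ), lam * (ξ ⬝ᵥ ξ) ≤ ξ ⬝ᵥ (a y *ᵥ ξ)) (hbd : ∀ y i j, |a y i j| ≤ Λ)
    (hu : ContDiff ℝ 1 u) (hu1 : ∀ y, 1 ≤ u y)
    (hweak : ∀ η : EuclideanSpace ℝ (Fin n) → ℝ, ContDiff ℝ 1 η → HasCompactSupport η →
      ∫ y, ∑ i, ∑ j, a y i j * fderiv ℝ u y (EuclideanSpace.single i 1) *
        fderiv ℝ η y (EuclideanSpace.single j 1) = 0)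
    {g : ℝ → ℝ} (hg : ContDiffOn ℝ 1 g (Ioi (1 / 2))) (hg' : ∀ s, 1 / 2 < s → 0 < deriv g s)
    {χ : EuclideanSpace ℝ (Fin n) → ℝ} (hχ : ContDiff ℝ 1 χ) (hχc : HasCompactSupport χ) :
    ∫ y, χ y ^ 2 * deriv g (u y) *
        ((fun i => fderiv ℝ u y (EuclideanSpace.single i 1)) ⬝ᵥ
          (a y *ᵥ fun i => fderiv ℝ u y (EuclideanSpace.single i 1))) ≤
      4 * ∫ y, g (u y) ^ 2 / deriv g (u y) *
        ((fun j => fderiv ℝ χ y (EuclideanSpace.single j 1)) ⬝ᵥ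
          (a y *ᵥ fun j => fderiv ℝ χ y (EuclideanSpace.single j 1))) := by
  set Du : EuclideanSpace ℝ (Fin n) → Fin n → ℝ := fun y i => fderiv ℝ u y (EuclideanSpace.single i 1) with hDu
  set Dχ : EuclideanSpace ℝ (Fin n) → Fin n → ℝ := fun y j => fderiv ℝ χ y (EuclideanSpace.single j 1) with hDχ
  have hid := energy_identity_weighted hsymm hlam hmeas hell hbd hu hu1 hweak hg hχ hχc
  have hcu := continuous_fderiv_single hu
  have hcχ := continuous_fderiv_single hχ
  have hgu : Continuous fun y => g (u y) :=
    (contDiff_testFun hu hu1 hg (contDiff_const (c := (1 : ℝ)))).continuous.congr fun y => by simp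
  have hg'u : Continuous fun y => deriv g (u y) := by
    have hg'c : ContinuousOn (deriv g) (Ioi (1 / 2)) := hg.continuousOn_deriv_of_isOpen isOpen_Ioi le_rfl
    refine hg'c.comp_continuous hu.continuous fun y => ?_
    have := hu1 y; simp only [mem_Ioi]; linarith
  have hg'pos : ∀ y, 0 < deriv g (u y) := fun y => hg' _ (by have := hu1 y; linarith)
  -- pointwise Young + Cauchy–Schwarz: `2|χ g B| ≤ ½ χ² g′ Q(Du) + 2 (g²/g′) Q(Dχ)`
  have hpt : ∀ y, 2 * |χ y * g (u y) * (Du y ⬝ᵥ (a y *ᵥ Dχ y))| ≤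
      (1 / 2) * (χ y ^ 2 * deriv g (u y) * (Du y ⬝ᵥ (a y *ᵥ Du y))) +
        2 * (g (u y) ^ 2 / deriv g (u y) * (Dχ y ⬝ᵥ (a y *ᵥ Dχ y))) := by
    intro y
    have hcs := quadForm_cauchySchwarz hsymm hlam hell y (Du y) (Dχ y)
    have hQ1 : 0 ≤ Du y ⬝ᵥ (a y *ᵥ Du y) :=
      (mul_nonneg hlam.le (Finset.sum_nonneg fun i _ => sq_nonneg (Du y i))).trans (quadForm_lower hell y _)
    have hQ2 : 0 ≤ Dχ y ⬝ᵥ (a y *ᵥ Dχ y) :=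
      (mul_nonneg hlam.le (Finset.sum_nonneg fun i _ => sq_nonneg (Dχ y i))).trans (quadForm_lower hell y _)
    have hgp := hg'pos y
    set A := (1 / 2) * (χ y ^ 2 * deriv g (u y) * (Du y ⬝ᵥ (a y *ᵥ Du y))) with hA
    set Cc := 2 * (g (u y) ^ 2 / deriv g (u y) * (Dχ y ⬝ᵥ (a y *ᵥ Dχ y))) with hC
    have hA0 : 0 ≤ A := by rw [hA]; positivity
    have hC0 : 0 ≤ Cc := by rw [hC]; positivity
    set x := χ y * g (u y) * (Du y ⬝ᵥ (a y *ᵥ Dχ y)) with hx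
    -- `x² ≤ A·Cc`
    have hx2 : x ^ 2 ≤ A * Cc := by
      have h1 : x ^ 2 = χ y ^ 2 * g (u y) ^ 2 * (Du y ⬝ᵥ (a y *ᵥ Dχ y)) ^ 2 := by rw [hx]; ring
      have h2 : A * Cc = χ y ^ 2 * g (u y) ^ 2 * ((Du y ⬝ᵥ (a y *ᵥ Du y)) * (Dχ y ⬝ᵥ (a y *ᵥ Dχ y))) := by
        rw [hA, hC]; field_simp
      rw [h1, h2]
      exact mul_le_mul_of_nonneg_left hcs (by positivity)
    nlinarith [sq_nonneg (A - Cc), sq_abs x, abs_nonneg x, hx2]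
  -- integrate
  have hI2 : Integrable fun y => χ y * g (u y) * (Du y ⬝ᵥ (a y *ᵥ Dχ y)) := by
    have h := integrable_mul_of_le_continuous (n := n) (m := fun y => Du y ⬝ᵥ (a y *ᵥ Dχ y))
      (M := fun y => n * Λ * (∑ i, Du y i ^ 2 + ∑ j, Dχ y j ^ 2) / 2) (φ := fun y => χ y * g (u y))
      (measurable_dotProduct_mulVec hmeas hcu hcχ) (by simp only [hDu, hDχ]; fun_prop)
      (fun y => abs_dotProduct_mulVec_le hsymm hlam hell hbd y _ _) (hχ.continuous.mul hgu) (hχc.mul_right)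
    exact h.congr (Eventually.of_forall fun y => by ring)
  have hIA : Integrable fun y => χ y ^ 2 * deriv g (u y) * (Du y ⬝ᵥ (a y *ᵥ Du y)) := by
    have h := integrable_mul_of_le_continuous (n := n) (m := fun y => Du y ⬝ᵥ (a y *ᵥ Du y))
      (M := fun y => n * Λ * (∑ i, Du y i ^ 2 + ∑ j, Du y j ^ 2) / 2) (φ := fun y => χ y ^ 2 * deriv g (u y))
      (measurable_dotProduct_mulVec hmeas hcu hcu) (by simp only [hDu]; fun_prop)
      (fun y => abs_dotProduct_mulVec_le hsymm hlam hell hbd y _ _) ((hχ.continuous.pow 2).mul hg'u)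
      (hasCompactSupport_testFun (u := u) (g := deriv g) hχc)
    exact h.congr (Eventually.of_forall fun y => by ring)
  have hIC : Integrable fun y => g (u y) ^ 2 / deriv g (u y) * (Dχ y ⬝ᵥ (a y *ᵥ Dχ y)) := by
    -- dominate by the continuous compactly supported `(g(u)²/g′(u)) · nΛ Σⱼ (∂ⱼχ)²`
    have hM : Integrable fun y => g (u y) ^ 2 / deriv g (u y) * (n * Λ * ∑ j, Dχ y j ^ 2) := by
      have hc : Continuous fun y => g (u y) ^ 2 / deriv g (u y) * (n * Λ * ∑ j, Dχ y j ^ 2) := by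
        refine ((hgu.pow 2).div hg'u fun y => (hg'pos y).ne').mul ?_
        simp only [hDχ]; fun_prop
      refine hc.integrable_of_hasCompactSupport ?_
      have hs : HasCompactSupport fun y => n * Λ * ∑ j, Dχ y j ^ 2 := by
        refine (hχc.fderiv (𝕜 := ℝ)).mono (Function.support_subset_iff'.2 fun y hy => ?_)
        simp only [Function.mem_support, not_not] at hy
        simp [hDχ, hy]
      exact hs.mul_left
    refine hM.mono' ?_ (Eventually.of_forall fun y => ?_)
    · exact ((hgu.pow 2).div hg'u fun y => (hg'pos y).ne').aestronglyMeasurable.mul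
        (measurable_dotProduct_mulVec hmeas hcχ hcχ).aestronglyMeasurable
    · have hq0 : 0 ≤ Dχ y ⬝ᵥ (a y *ᵥ Dχ y) :=
        (mul_nonneg hlam.le (Finset.sum_nonneg fun i _ => sq_nonneg (Dχ y i))).trans (quadForm_lower hell y _)
      have hfac : 0 ≤ g (u y) ^ 2 / deriv g (u y) := div_nonneg (sq_nonneg _) (hg'pos y).le
      rw [Real.norm_eq_abs, abs_of_nonneg (mul_nonneg hfac hq0)]
      exact mul_le_mul_of_nonneg_left (quadForm_upper hbd y _) hfac
  have hint : ∫ y, χ y ^ 2 * deriv g (u y) * (Du y ⬝ᵥ (a y *ᵥ Du y)) ≤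
      (1 / 2) * (∫ y, χ y ^ 2 * deriv g (u y) * (Du y ⬝ᵥ (a y *ᵥ Du y))) +
        2 * (∫ y, g (u y) ^ 2 / deriv g (u y) * (Dχ y ⬝ᵥ (a y *ᵥ Dχ y))) := by
    calc ∫ y, χ y ^ 2 * deriv g (u y) * (Du y ⬝ᵥ (a y *ᵥ Du y))
        = -2 * ∫ y, χ y * g (u y) * (Du y ⬝ᵥ (a y *ᵥ Dχ y)) := hid
      _ ≤ ∫ y, 2 * |χ y * g (u y) * (Du y ⬝ᵥ (a y *ᵥ Dχ y))| := by
          rw [← integral_const_mul]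
          refine integral_mono (hI2.const_mul _) (hI2.abs.const_mul 2) fun y => ?_
          have := neg_abs_le (χ y * g (u y) * (Du y ⬝ᵥ (a y *ᵥ Dχ y)))
          simp only; linarith
      _ ≤ ∫ y, ((1 / 2) * (χ y ^ 2 * deriv g (u y) * (Du y ⬝ᵥ (a y *ᵥ Du y))) +
            2 * (g (u y) ^ 2 / deriv g (u y) * (Dχ y ⬝ᵥ (a y *ᵥ Dχ y)))) :=
          integral_mono (hI2.abs.const_mul 2) ((hIA.const_mul _).add (hIC.const_mul _)) hpt
      _ = (1 / 2) * (∫ y, χ y ^ 2 * deriv g (u y) * (Du y ⬝ᵥ (a y *ᵥ Du y))) +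
            2 * (∫ y, g (u y) ^ 2 / deriv g (u y) * (Dχ y ⬝ᵥ (a y *ᵥ Dχ y))) := by
          rw [integral_add (hIA.const_mul _) (hIC.const_mul _), integral_const_mul, integral_const_mul]
  linarith

end Summit.NavierStokesRegularity.NavierStokesRegularity.Theorems.PoloidalWindowDoorPoloidalWindowRigidityDivFormCaccioppoli

end
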